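import Summits.BirchSwinnertonDyer.Rank1Residual.X2.IsogenyLineTypeGoodOrdinary
import Summits.BirchSwinnertonDyer.Rank1Residual.X2.GreenbergVatsalCaseOneGoodOrdinary
import Summits.BirchSwinnertonDyer.Rank1Residual.X2.GreenbergVatsalCaseTwo
import Literature.NumberTheory.EllipticCurves.GreenbergVatsal2000.IwasawaInvariants
import Literature.NumberTheory.EllipticCurves.Wuthrich2014.ReducibleDivisibility
import Literature.NumberTheory.EllipticCurves.GreenbergVatsal2000.EisensteinCongruenceResidualGoodOrdinary
import HarnessLib

/-!
# Greenberg–Vatsal Thm. (1.3) IN ITS PRINTED SETTING (good ordinary Eisenstein prime): CASE 2 by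
# the isogeny `E → E/Φ₀`, both parity cases, and — with Kato–Wuthrich — the registered fact
# `GreenbergVatsal2000.thm13_charIdeal_eq_of_gvPar` (GV Thm. (1.3) + Thm. (1.2) ⇒ Mazur's MC under
# (GV)) DERIVED from GV's numbered §2/§3 statements (cell `b2b-bsdres`, unit
# `b2b-bsdres-eisenstein-p2`, gen 20; X2-GAP §24.6 3(i) / §25)

HONEST FRAMING (run/shared/lean/b2b/bsd-rank1-residual/, verbatim in every file): the goal of the
cell is to DELETE the COMBINATION-SHAPED residual classes of the Birch–Swinnerton-Dyer formula for
ALL analytic-rank `≤ 1` elliptic curves over `ℚ` — "full BSD formula for every rank `≤ 1` curve in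
class `C`" assembled STRICTLY from published theorems — so that the rank-`≤ 1` remainder becomes
exactly the CONSTRUCTION-SHAPED classes, which are TYPED (missing-input `Prop`s), NOT attempted.
This is not "finishing BSD". Research route; NO CLAIM BEYOND STATED CLASSES; nothing here changes
a label (X1's GV-parity cells C7 / the `gvpar` rows are COVERED by the PRINTED GV Thm. (1.3), a
registered PUB fact; this file RE-DERIVES that fact in the kernel from GV's numbered §2/§3
statements — the same chain that carries the X2a flag `GV00-mult-asserted` at `p ‖ N`, now run in
the paper's own setting as a cross-check; it books nothing and proposes no label). THEOREMS ONLY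
(no `def`, no named fact, no `sorry`); the analytic input GV Thm. (3.11) + (28) + p. 43 (good
ordinary case) enters as the DISPLAYED HYPOTHESIS `hAn` = word for word the body of the Literature
reading-fact `nonPrimitive_unitContent_and_lambda_eq_residual_of_lineRamifiedEven_goodOrd`
(p253710, `GreenbergVatsal2000/EisensteinCongruenceResidualGoodOrdinary.lean`), and §4 feeds that
registered fact in: `thm13_charIdeal_eq_of_gvPar_of_facts`.

WHAT.
* §1 **`caseTwo_clause_goodOrd`** — GV CASE 2 (rational line UNRAMIFIED at `p` and ODD) at a good
  ordinary prime, by Greenberg–Vatsal's own reduction (p. 28: "The `λ`-invariant is always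
  unchanged by an isogeny. Thus, we may assume … `φ` is ramified and even"): the quotient
  `E' = E/Φ₀` on a globally minimal model (gen 18 `exists_isogeny_ker_eq_line`) carries the
  RAMIFIED-EVEN line `E[p]/Φ₀` (gen 20 `exists_rationalLine_ramified_even_of_isogeny_goodOrd`, the
  reduction line as local input), is good ordinary at `p` with THE SAME unit root and newform
  (`unitRoot_eq_of_isIsogenous`, `IsNewformOf.of_isIsogenous`); CASE 1 for `E'`
  (`caseOne_clause_goodOrd`); `λ(E) = λ(E')` (KERNEL theorem `lambdaInvariant_eq_of_isogeny`,
  gen 18) and `μ = 0` on both sides (Greenberg Prop. 5.10); the period input GV Cor. (3.8) (`hP`,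
  A180: `Ω_{E'} = u·Ω_E`, `|u|_p = 1`) so that `ϖ' = ϖ/u`, `b = C(u)·b'`.
* §2 **`lambda_muAnal_goodOrd_of_gvPar`** — both cases: at an odd GOOD ORDINARY prime under (GV),
  every `b ∈ Λ` with `ι b = ϖ · padicLFunction f (unitRoot W p)` has unit content and
  `ord_T(b mod p) = ord_T(f_E mod p)` (`μ^{anal} = 0`, `λ^{anal} = λ^{alg}`; `μ^{alg} = 0` is Prop. 5.10)
  — GV Thm. (1.3)'s `λ`/`μ` conclusion, the good-ordinary analogue of A64.
* §3 **`thm13_charIdeal_eq_of_gvPar_of_shapes : … → GreenbergVatsal2000.thm13_charIdeal_eq_of_gvPar`**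
  — the registered fact (GV Thm. (1.3) + Kato's Thm. (1.2) ⇒ `char_Λ X = (g)`, `ι g = ϖ·L_p`)
  DERIVED: Wuthrich 2014 Thm. 16 good-ordinary clause (`hW16`, registered: `g ∈ char_Λ X` with
  `ι g = ϖ·L_p`) gives `g = c·f_E`; §2 gives `μ(g) = 0`, `ord_T(g mod p) = ord_T(f_E mod p)`; GV's
  deduction p. 20 (`isUnit_of_mul_eq_of_order_map_eq`) makes `c` a unit, so `char_Λ X = (g)`.
  Inputs: registered facts p221999 (`hGV`), A115 (`hA`), A116 (`hB`), Greenberg Prop. 5.10 (`hG`),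
  A195 lifting (`hLiftF`), A180 Cor. (3.8) (`hP`), Wuthrich Thm. 16 (`hW16`) + the shape `hAn`.
* §4 **`thm13_charIdeal_eq_of_gvPar_of_facts`** — the same with `hAn :=` the registered
  reading-fact `nonPrimitive_unitContent_and_lambda_eq_residual_of_lineRamifiedEven_goodOrd`
  (p253710): GV Thm. (1.3) (+ Kato) from REGISTERED LITERATURE FACTS ONLY — {p221999, A115, A116,
  Greenberg Prop. 5.10, A195, A180, Wuthrich Thm. 16, p253710}.

References: [GreenbergVatsal2000] Thms. (1.1)–(1.3), p. 20; §2 (16), p. 28; §3 Thm. (3.11), (28),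
p. 43, Cor. (3.8); [GreenbergLNM1716] Prop. 5.10; [Wuthrich2014] Thm. 16; [Kato2004Asterisque]
Thm. 17.4; HOME/b2b-bsdres-eisenstein-p2/X2-GAP.md §23–§25.
-/

set_option autoImplicit false

noncomputable section

open scoped Classical AddSubgroup MatrixGroups ModularForm

open PowerSeries NumberField IsDedekindDomain Field WeierstrassCurve CongruenceSubgroup
  Literature.NumberTheory.EllipticCurves Literature.NumberTheory.EllipticCurves.GreenbergVatsal2000
  Literature.NumberTheory.EllipticCurves.ModularForms
  Literature.NumberTheory.EllipticCurves.Rank1Residual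
  Summit.BirchSwinnertonDyer.Rank1Residual.X2.IsogenyQuotientLine
  Summit.BirchSwinnertonDyer.Rank1Residual.X2.IsogenyLineTypeGoodOrdinary
  Summit.BirchSwinnertonDyer.Rank1Residual.X2.IsogenyLambdaInvariant
  Summit.BirchSwinnertonDyer.Rank1Residual.X2.GreenbergVatsalAnalyticTransferCore
  Summit.BirchSwinnertonDyer.Rank1Residual.X2.GreenbergVatsalCaseTwo
  Summit.BirchSwinnertonDyer.Rank1Residual.X2.GreenbergVatsalCaseOneGoodOrdinary

namespace Summit.BirchSwinnertonDyer.Rank1Residual.X2.GreenbergVatsalThm13GoodOrdinary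

/-! ## §1. CASE 2 at a good ordinary prime, by the isogeny `E → E/Φ₀` -/

/-- **GV Thm. (1.3), CASE 2 (rational line UNRAMIFIED at `p` and ODD), at a GOOD ORDINARY prime —
`μ^{anal}_E = 0` and `λ^{anal}_E = λ^{alg}_E`**, by Greenberg–Vatsal's own reduction (p. 28): for
`E/ℚ` globally minimal, `p ≠ 2` good ordinary, `Φ₀` unramified-odd, `κ` cyclotomic with generator
`γ`, `f` the newform, `ϖ·Ω_E = Ω⁺_f`, any dual datum `D` and generator `f_E` of `char_Λ X`: every
`b ∈ Λ` with `ι b = ϖ · padicLFunction f (unitRoot W p)` has unit content and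
`ord_T(b mod p) = ord_T(f_E mod p)`. From: the quotient `E' = E/Φ₀` (globally minimal, good ordinary
at `p`, same `a_p`, same unit root, same newform) with its RAMIFIED-EVEN line `E[p]/Φ₀`
(`exists_rationalLine_ramified_even_of_isogeny_goodOrd`); CASE 1 for `E'` (`caseOne_clause_goodOrd`,
any dual datum `D'`); "the `λ`-invariant is always unchanged by an isogeny" — KERNEL theorem
`lambdaInvariant_eq_of_isogeny` — and `μ = 0` on both sides (Prop. 5.10, `hG`), so
`ord_T(f_E mod p) = λ(E) = λ(E') = ord_T(f_{E'} mod p)`; GV Cor. (3.8) (`hP`: `Ω_{E'} = u·Ω_E`,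
`|u|_p = 1`), so `ϖ' = ϖ/u` and `b = C(u)·b'`. Registered facts `hGV` (p221999), `hA` (A115), `hB`
(A116), `hG`, `hLiftF` (A195), `hP` (A180) + the displayed analytic hypothesis `hAn` (GV Thm. (3.11)
+ (28) + p. 43, good ordinary case). [cite: GreenbergVatsal2000, Thm. (1.3), §2 p. 28, §3 Cor. (3.8)]
[cite: GreenbergLNM1716, Prop. 5.10 (PDF p. 147)] -/
theorem caseTwo_clause_goodOrd
    (hGV : imKummer_ge_greenbergCondition_at_p) (hA : lambda_nonPrimitive_eq_add_sum_delta)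
    (hB : divisible_nonPrimitiveSelmerInfty_of_mu_eq_zero)
    (hG : Greenberg1999.prop510_isTorsion_hasUnitContent_of_gvPar)
    (hLiftF : residualEpsilon_surjOn_of_lineRamifiedEven)
    (hAn : ∀ (W : WeierstrassCurve ℚ) [W.IsGloballyMinimal] [W.IsElliptic] (p : ℕ) [Fact p.Prime]
      (κ : ZpExtension ℚ p) {N : ℕ} [NeZero N] (f : CuspForm (Gamma0 N) 2)
      (S₀ : Finset (HeightOneSpectrum (𝓞 ℚ)))
      (Φ₀ : AddSubgroup (W.geomTorsion (p : ℤ))) (hΦ : IsRationalLine W p Φ₀),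
      p ≠ 2 → W.HasGoodReductionAtPrime p → ¬ (p : ℤ) ∣ W.frobeniusTrace p → κ.IsCyclotomic →
      ¬ LineUnramifiedAt W p Φ₀ → LineEven W p Φ₀ → IsNewformOf W f →
      (∀ v ∈ S₀, ((p : ℕ) : 𝓞 ℚ) ∉ v.asIdeal) →
      (∀ v : HeightOneSpectrum (𝓞 ℚ), v ∉ S₀ → ((p : ℕ) : 𝓞 ℚ) ∉ v.asIdeal →
        W.HasGoodReductionAt v) →
      ∀ (ϖ : ℚ), (ϖ : ℝ) * W.realPeriodRat = plusPeriod f →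
      ∀ (b : IwasawaAlgebra p),
        iwasawaToPowerSeries p b =
          PowerSeries.C ((ϖ : ℚ) : ℚ_[p]) * padicLFunction f (unitRoot W p : ℚ_[p]) →
        HasUnitContent (b * eulerFactorProduct W p S₀) ∧
          p ^ (PowerSeries.map (PadicInt.toZMod (p := p)) (b * eulerFactorProduct W p S₀)).order.toNat =
            Nat.card (residualLineH1 W p κ S₀ Φ₀ hΦ) * Nat.card (residualQuotSelmer W p κ S₀ Φ₀ hΦ))
    (hP : cor38_realPeriodRat_eq_unit_mul_of_isIsogenous_of_gvPar)
    (W : WeierstrassCurve ℚ) [W.IsElliptic] [W.IsGloballyMinimal] (p : ℕ) [Fact p.Prime]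
    {κ : ZpExtension ℚ p} {γ : absoluteGaloisGroup ℚ} {N : ℕ} [NeZero N]
    {f : CuspForm (Gamma0 N) 2}
    (hp : p ≠ 2) (hgood : W.HasGoodReductionAtPrime p) (hord : ¬ (p : ℤ) ∣ W.frobeniusTrace p)
    {Φ₀ : AddSubgroup (W.geomTorsion (p : ℤ))} (hΦ : IsRationalLine W p Φ₀)
    (hunr : LineUnramifiedAt W p Φ₀) (hodd : LineOdd W p Φ₀)
    (hκ : κ.IsCyclotomic) (hγ : κ.IsTopGenerator γ) (hf : IsNewformOf W f)
    (D : W.SelmerDualData κ γ) (ϖ : ℚ) (hϖ : (ϖ : ℝ) * W.realPeriodRat = plusPeriod f)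
    (fE : IwasawaAlgebra p) (hchar : D.charIdeal = Ideal.span {fE}) :
    ∀ (b : IwasawaAlgebra p),
      iwasawaToPowerSeries p b =
        PowerSeries.C ((ϖ : ℚ) : ℚ_[p]) * padicLFunction f (unitRoot W p : ℚ_[p]) →
      HasUnitContent b ∧
        (PowerSeries.map (PadicInt.toZMod (p := p)) b).order =
          (PowerSeries.map (PadicInt.toZMod (p := p)) fE).order := by
  intro b hιb
  -- the quotient `E' = E/Φ₀` on a globally minimal model, with its ramified-even line
  obtain ⟨W', _, _, g, hker, -⟩ := exists_isogeny_ker_eq_line hΦ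
  obtain ⟨Φ', hΦ', hram', heven'⟩ :=
    exists_rationalLine_ramified_even_of_isogeny_goodOrd hp hgood hord hΦ hunr hodd g hker
  have hiso : IsIsogenous W W' := ⟨g⟩
  have hgood' : W'.HasGoodReductionAtPrime p := hasGoodReductionAtPrime_of_isIsogenous hiso hgood
  have hord' : ¬ (p : ℤ) ∣ W'.frobeniusTrace p := not_dvd_frobeniusTrace_of_isIsogenous hiso hgood hord
  have hα : unitRoot W p = unitRoot W' p := unitRoot_eq_of_isIsogenous hiso hgood
  have hf' : IsNewformOf W' f := hf.of_isIsogenous hiso.symm_of_charZero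
  have hgv : GVPar W p := ⟨Φ₀, hΦ, Or.inr ⟨hunr, hodd⟩⟩
  have hgv' : GVPar W' p := ⟨Φ', hΦ', Or.inl ⟨hram', heven'⟩⟩
  rw [hα] at hιb
  -- the period: `Ω_{E'} = u · Ω_E`, `|u|_p = 1` (GV Cor. (3.8))
  obtain ⟨u, hu1, hΩ⟩ := hP W W' p hp hf (Or.inl ⟨hgood, hord⟩) hiso hgv hgv'
  have hu0 : (u : ℚ_[p]) ≠ 0 := fun h ↦ by simp [h] at hu1
  have hu0' : u ≠ 0 := fun h ↦ hu0 (by rw [h, Rat.cast_zero])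
  set cU : ℤ_[p]ˣ := PadicInt.mkUnits hu1 with hcU
  have hcUinv : (((cU⁻¹ : ℤ_[p]ˣ) : ℤ_[p]) : ℚ_[p]) = (u : ℚ_[p])⁻¹ := by
    apply eq_inv_of_mul_eq_one_left
    rw [← PadicInt.mkUnits_eq hu1, ← PadicInt.coe_mul, Units.inv_mul, PadicInt.coe_one]
  have hϖ' : ((ϖ / u : ℚ) : ℝ) * W'.realPeriodRat = plusPeriod f := by
    rw [hΩ, Rat.cast_div, ← hϖ, ← mul_assoc,
      div_mul_cancel₀ _ (by exact_mod_cast hu0' : (u : ℝ) ≠ 0)]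
  -- a dual datum for `E'`; `μ = 0` on both sides (Prop. 5.10); `λ(E) = λ(E')` (isogeny invariance)
  obtain ⟨D'⟩ := W'.nonempty_selmerDualData_holds κ γ hγ
  haveI := WeierstrassCurve.SelmerDualData.module_finite_of_isCyclotomic W κ hκ D hγ
  haveI := WeierstrassCurve.SelmerDualData.module_finite_of_isCyclotomic W' κ hκ D' hγ
  obtain ⟨hX, fE₀, hchar₀, huf₀⟩ := hG.of_goodOrd W p hp hgood hord hgv hκ hγ D
  obtain ⟨hX', fE', hchar', huf'⟩ := hG.of_goodOrd W' p hp hgood' hord' hgv' hκ hγ D'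
  have hμ : D.mu = 0 := (mu_eq_zero_iff_hasUnitContent D hX hchar₀).mpr huf₀
  have hμ' : D'.mu = 0 := (mu_eq_zero_iff_hasUnitContent D' hX' hchar').mpr huf'
  have hordfE : (PowerSeries.map (PadicInt.toZMod (p := p)) fE).order =
      (PowerSeries.map (PadicInt.toZMod (p := p)) fE').order := by
    rw [← natCast_lambdaInvariant_eq_order_map_toZMod D hX hμ hchar,
      ← natCast_lambdaInvariant_eq_order_map_toZMod D' hX' hμ' hchar',
      lambdaInvariant_eq_of_isogeny g D D']
  -- CASE 1 for `E'`
  have hcl' := caseOne_clause_goodOrd hGV hA hB hG hLiftF hAn W' p hp hgood' hord' hΦ' hram' heven'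
    hκ hγ hf' D' (ϖ / u) hϖ' fE' hchar'
  -- transport of `b`: `b' = C(c⁻¹)·b` has `ι b' = (ϖ/u)·L_p`, and `b = C(c)·b'`
  have key : iwasawaToPowerSeries p (PowerSeries.C ((cU⁻¹ : ℤ_[p]ˣ) : ℤ_[p]) * b) =
        PowerSeries.C (((ϖ / u : ℚ)) : ℚ_[p]) * padicLFunction f (unitRoot W' p : ℚ_[p]) ∧
      b = PowerSeries.C ((cU : ℤ_[p]ˣ) : ℤ_[p]) * (PowerSeries.C ((cU⁻¹ : ℤ_[p]ˣ) : ℤ_[p]) * b) := by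
    refine ⟨?_, ?_⟩
    · rw [iwasawaToPowerSeries_C_mul, hιb, ← mul_assoc, ← map_mul, Rat.cast_div, div_eq_inv_mul,
        hcUinv]
    · rw [← mul_assoc, ← map_mul, Units.mul_inv, map_one, one_mul]
  obtain ⟨hιb', hb⟩ := key
  obtain ⟨hub', hord''⟩ := hcl' _ hιb'
  obtain ⟨hC1, hC2⟩ := hasUnitContent_and_order_C_mul cU
    (PowerSeries.C ((cU⁻¹ : ℤ_[p]ˣ) : ℤ_[p]) * b)
  refine ⟨?_, ?_⟩
  · rw [hb]; exact hC1.mpr hub'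
  · rw [hb, hC2, hord'', hordfE]

/-! ## §2. Both cases: GV Thm. (1.3)'s `λ`/`μ` conclusion at a good ordinary prime -/

/-- **GV Thm. (1.3) at an odd GOOD ORDINARY prime under (GV) — `μ^{anal}_E = 0`,
`λ^{anal}_E = λ^{alg}_E` — from GV's numbered §2/§3 statements** (the good-ordinary analogue of the
X2 flag fact A64 `lambda_muAnal_multiplicative_of_gvPar`): for `E/ℚ` globally minimal, `p ≠ 2` good
ordinary, `GVPar W p`, `κ` cyclotomic with generator `γ`, `f` the newform, `ϖ·Ω_E = Ω⁺_f`, any dual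
datum `D`, any generator `f_E` of `char_Λ X`, EVERY `b ∈ Λ` with `ι b = ϖ·padicLFunction f (unitRoot W p)`
has unit content and `ord_T(b mod p) = ord_T(f_E mod p)`. CASE 1 = `caseOne_clause_goodOrd`, CASE 2
= `caseTwo_clause_goodOrd`. [cite: GreenbergVatsal2000, Thm. (1.3) with §2 (16), p. 28 and §3 Thm. (3.11), Cor. (3.8)] -/
theorem lambda_muAnal_goodOrd_of_gvPar
    (hGV : imKummer_ge_greenbergCondition_at_p) (hA : lambda_nonPrimitive_eq_add_sum_delta)
    (hB : divisible_nonPrimitiveSelmerInfty_of_mu_eq_zero)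
    (hG : Greenberg1999.prop510_isTorsion_hasUnitContent_of_gvPar)
    (hLiftF : residualEpsilon_surjOn_of_lineRamifiedEven)
    (hAn : ∀ (W : WeierstrassCurve ℚ) [W.IsGloballyMinimal] [W.IsElliptic] (p : ℕ) [Fact p.Prime]
      (κ : ZpExtension ℚ p) {N : ℕ} [NeZero N] (f : CuspForm (Gamma0 N) 2)
      (S₀ : Finset (HeightOneSpectrum (𝓞 ℚ)))
      (Φ₀ : AddSubgroup (W.geomTorsion (p : ℤ))) (hΦ : IsRationalLine W p Φ₀),
      p ≠ 2 → W.HasGoodReductionAtPrime p → ¬ (p : ℤ) ∣ W.frobeniusTrace p → κ.IsCyclotomic →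
      ¬ LineUnramifiedAt W p Φ₀ → LineEven W p Φ₀ → IsNewformOf W f →
      (∀ v ∈ S₀, ((p : ℕ) : 𝓞 ℚ) ∉ v.asIdeal) →
      (∀ v : HeightOneSpectrum (𝓞 ℚ), v ∉ S₀ → ((p : ℕ) : 𝓞 ℚ) ∉ v.asIdeal →
        W.HasGoodReductionAt v) →
      ∀ (ϖ : ℚ), (ϖ : ℝ) * W.realPeriodRat = plusPeriod f →
      ∀ (b : IwasawaAlgebra p),
        iwasawaToPowerSeries p b =
          PowerSeries.C ((ϖ : ℚ) : ℚ_[p]) * padicLFunction f (unitRoot W p : ℚ_[p]) →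
        HasUnitContent (b * eulerFactorProduct W p S₀) ∧
          p ^ (PowerSeries.map (PadicInt.toZMod (p := p)) (b * eulerFactorProduct W p S₀)).order.toNat =
            Nat.card (residualLineH1 W p κ S₀ Φ₀ hΦ) * Nat.card (residualQuotSelmer W p κ S₀ Φ₀ hΦ))
    (hP : cor38_realPeriodRat_eq_unit_mul_of_isIsogenous_of_gvPar)
    (W : WeierstrassCurve ℚ) [W.IsElliptic] [W.IsGloballyMinimal] (p : ℕ) [Fact p.Prime]
    {κ : ZpExtension ℚ p} {γ : absoluteGaloisGroup ℚ} {N : ℕ} [NeZero N]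
    {f : CuspForm (Gamma0 N) 2}
    (hp : p ≠ 2) (hgood : W.HasGoodReductionAtPrime p) (hord : ¬ (p : ℤ) ∣ W.frobeniusTrace p)
    (hpar : GVPar W p) (hκ : κ.IsCyclotomic) (hγ : κ.IsTopGenerator γ) (hf : IsNewformOf W f)
    (D : W.SelmerDualData κ γ) (ϖ : ℚ) (hϖ : (ϖ : ℝ) * W.realPeriodRat = plusPeriod f)
    (fE : IwasawaAlgebra p) (hchar : D.charIdeal = Ideal.span {fE}) :
    ∀ (b : IwasawaAlgebra p),
      iwasawaToPowerSeries p b =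
        PowerSeries.C ((ϖ : ℚ) : ℚ_[p]) * padicLFunction f (unitRoot W p : ℚ_[p]) →
      HasUnitContent b ∧
        (PowerSeries.map (PadicInt.toZMod (p := p)) b).order =
          (PowerSeries.map (PadicInt.toZMod (p := p)) fE).order := by
  obtain ⟨Φ₀, hΦ, hcase⟩ := hpar
  rcases hcase with ⟨hram, heven⟩ | ⟨hunr, hodd⟩
  · exact caseOne_clause_goodOrd hGV hA hB hG hLiftF hAn W p hp hgood hord hΦ hram heven hκ hγ hf D ϖ
      hϖ fE hchar
  · exact caseTwo_clause_goodOrd hGV hA hB hG hLiftF hAn hP W p hp hgood hord hΦ hunr hodd hκ hγ hf D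
      ϖ hϖ fE hchar

/-! ## §3. The registered fact `thm13_charIdeal_eq_of_gvPar` DERIVED (with Kato–Wuthrich) -/

/-- (GV) gives a rational line, hence `E[p]` is reducible (Wuthrich Thm. 16's hypothesis). -/
private theorem not_irr_of_gvPar {W : WeierstrassCurve ℚ} [W.IsElliptic] {p : ℕ} [Fact p.Prime]
    (hpar : GVPar W p) : ¬ W.HasIrreducibleModPGaloisRep p := by
  obtain ⟨Φ, hΦ, -⟩ := hpar
  exact not_hasIrreducibleModPGaloisRep_of_isRationalLine hΦ

/-- **`GreenbergVatsal2000.thm13_charIdeal_eq_of_gvPar` (GV Thm. (1.3) + Thm. (1.2) ⇒ Mazur's main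
conjecture `char_Λ X(E/ℚ_∞) = (L(E/ℚ,T))` at an odd good ordinary Eisenstein prime under (GV), the
registered PUB fact covering X1's GV-parity cells) DERIVED** from GV's numbered statements and the
cell's registered facts: `hGV` (GV p. 26 / Greenberg Props. 2.2–2.4, p221999), `hA` (A115, GV
(6)–(7)), `hB` (A116, GV Prop. 2.5), Greenberg 1999 Prop. 5.10 (`hG`: torsion, `char X = (f_E)`,
`μ(f_E) = 0`), the lifting reading-fact GV p. 28/30 (`hLiftF`, A195), GV Cor. (3.8) (`hP`, A180),
Wuthrich 2014 Thm. 16 good-ordinary clause (`hW16`: `ϖ·L_p = ι g`, `g ∈ char_Λ X` — Kato's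
Thm. (1.2) made integral), and the displayed analytic hypothesis `hAn` (GV Thm. (3.11) + (28) +
p. 43, good ordinary case = the body of the reading-fact
`nonPrimitive_unitContent_and_lambda_eq_residual_of_lineRamifiedEven_goodOrd`). Proof = GV p. 20:
`g = c·f_E` (Wuthrich), `μ(g) = 0` and `ord_T(g mod p) = ord_T(f_E mod p)` (§2), so `c ∈ Λˣ`
(`isUnit_of_mul_eq_of_order_map_eq`) and `char_Λ X = (f_E) = (g)` with `ι g = ϖ·L_p(f, α)`.
[cite: GreenbergVatsal2000, Thm. (1.3), Thm. (1.2) and p. 20 (arXiv p. 4); §2 (16), p. 28; §3 Thm. (3.11), (28), p. 43, Cor. (3.8)]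
[cite: Wuthrich2014, Thm. 16 (p. 397)] [cite: GreenbergLNM1716, Prop. 5.10 (PDF p. 147)] -/
theorem thm13_charIdeal_eq_of_gvPar_of_shapes
    (hGV : imKummer_ge_greenbergCondition_at_p) (hA : lambda_nonPrimitive_eq_add_sum_delta)
    (hB : divisible_nonPrimitiveSelmerInfty_of_mu_eq_zero)
    (hG : Greenberg1999.prop510_isTorsion_hasUnitContent_of_gvPar)
    (hLiftF : residualEpsilon_surjOn_of_lineRamifiedEven)
    (hAn : ∀ (W : WeierstrassCurve ℚ) [W.IsGloballyMinimal] [W.IsElliptic] (p : ℕ) [Fact p.Prime]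
      (κ : ZpExtension ℚ p) {N : ℕ} [NeZero N] (f : CuspForm (Gamma0 N) 2)
      (S₀ : Finset (HeightOneSpectrum (𝓞 ℚ)))
      (Φ₀ : AddSubgroup (W.geomTorsion (p : ℤ))) (hΦ : IsRationalLine W p Φ₀),
      p ≠ 2 → W.HasGoodReductionAtPrime p → ¬ (p : ℤ) ∣ W.frobeniusTrace p → κ.IsCyclotomic →
      ¬ LineUnramifiedAt W p Φ₀ → LineEven W p Φ₀ → IsNewformOf W f →
      (∀ v ∈ S₀, ((p : ℕ) : 𝓞 ℚ) ∉ v.asIdeal) →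
      (∀ v : HeightOneSpectrum (𝓞 ℚ), v ∉ S₀ → ((p : ℕ) : 𝓞 ℚ) ∉ v.asIdeal →
        W.HasGoodReductionAt v) →
      ∀ (ϖ : ℚ), (ϖ : ℝ) * W.realPeriodRat = plusPeriod f →
      ∀ (b : IwasawaAlgebra p),
        iwasawaToPowerSeries p b =
          PowerSeries.C ((ϖ : ℚ) : ℚ_[p]) * padicLFunction f (unitRoot W p : ℚ_[p]) →
        HasUnitContent (b * eulerFactorProduct W p S₀) ∧
          p ^ (PowerSeries.map (PadicInt.toZMod (p := p)) (b * eulerFactorProduct W p S₀)).order.toNat =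
            Nat.card (residualLineH1 W p κ S₀ Φ₀ hΦ) * Nat.card (residualQuotSelmer W p κ S₀ Φ₀ hΦ))
    (hP : cor38_realPeriodRat_eq_unit_mul_of_isIsogenous_of_gvPar)
    (hW16 : Wuthrich2014.charIdeal_dvd_padicLFunction) :
    thm13_charIdeal_eq_of_gvPar := by
  intro W _ _ p _ hp hgood hord hpar κ γ hκ hγ hγ' _ f hf ϖ hϖ D
  -- Greenberg Prop. 5.10: torsion, `char X = (f_E)` with `μ(f_E) = 0`
  obtain ⟨hX, fE, hchar, -⟩ := hG.of_goodOrd W p hp hgood hord hpar hκ hγ D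
  -- Wuthrich Thm. 16 (Kato made integral): `ϖ·L_p = ι g`, `g ∈ char X`
  obtain ⟨-, g, hg, hιg⟩ := hW16 W p hp ((isOrdinaryAt_iff W p).mpr ⟨hgood, hord⟩)
    (not_irr_of_gvPar hpar) hκ hγ hγ' hf D ϖ hϖ
  -- GV Thm. (1.3): `μ(g) = 0`, `ord_T(g mod p) = ord_T(f_E mod p)`
  obtain ⟨hug, hordg⟩ := lambda_muAnal_goodOrd_of_gvPar hGV hA hB hG hLiftF hAn hP W p hp hgood hord
    hpar hκ hγ hf D ϖ hϖ fE hchar g hιg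
  -- GV p. 20: `g = c·f_E` with `c` a unit, so `char X = (g)`
  rw [hchar] at hg
  obtain ⟨c, hc⟩ := Ideal.mem_span_singleton'.mp hg
  have hcu : IsUnit c := isUnit_of_mul_eq_of_order_map_eq ((mul_comm fE c).trans hc) hug hordg
  refine ⟨hX, g, ?_, hιg⟩
  rw [hchar, ← hc, Ideal.span_singleton_mul_left_unit hcu]

/-! ## §4. From REGISTERED LITERATURE FACTS ONLY -/

/-- **`GreenbergVatsal2000.thm13_charIdeal_eq_of_gvPar` (GV Thm. (1.3) with Kato's Thm. (1.2):
Mazur's main conjecture at an odd good ordinary Eisenstein prime under (GV)) FROM REGISTERED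
LITERATURE FACTS ONLY**: `hGV` (GV p. 26 / Greenberg LNM 1716 Props. 2.2–2.4, p221999), `hA` (A115,
GV (6)–(7)), `hB` (A116, GV Prop. 2.5), Greenberg 1999 Prop. 5.10 (`hG`), GV p. 28/30 lifting
(`hLiftF`, A195), **GV Thm. (3.11) + (28) + p. 43 in the printed good ordinary case (`hAnF`,
p253710)**, GV Cor. (3.8) (`hP`, A180), Wuthrich 2014 Thm. 16 (`hW16`). The registered PUB fact
(GV's Thm. (1.3) as printed) is thereby ALSO a derived term of the numbered §2/§3 statements — the
same kernel chain (devissage (16), Euler factors (9), cancellation, isogeny reduction) that carries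
the X2a flag `GV00-mult-asserted` at `p ‖ N`, run in the paper's own setting.
[cite: GreenbergVatsal2000, Thm. (1.3), Thm. (1.2), p. 20; §2 (16), pp. 26–30; §3 Thm. (3.11), (28), p. 43, Cor. (3.8)]
[cite: Wuthrich2014, Thm. 16 (p. 397)] [cite: GreenbergLNM1716, Prop. 5.10 (PDF p. 147), Props. 2.2–2.4] -/
theorem thm13_charIdeal_eq_of_gvPar_of_facts
    (hGV : imKummer_ge_greenbergCondition_at_p) (hA : lambda_nonPrimitive_eq_add_sum_delta)
    (hB : divisible_nonPrimitiveSelmerInfty_of_mu_eq_zero)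
    (hG : Greenberg1999.prop510_isTorsion_hasUnitContent_of_gvPar)
    (hLiftF : residualEpsilon_surjOn_of_lineRamifiedEven)
    (hAnF : nonPrimitive_unitContent_and_lambda_eq_residual_of_lineRamifiedEven_goodOrd)
    (hP : cor38_realPeriodRat_eq_unit_mul_of_isIsogenous_of_gvPar)
    (hW16 : Wuthrich2014.charIdeal_dvd_padicLFunction) :
    thm13_charIdeal_eq_of_gvPar :=
  thm13_charIdeal_eq_of_gvPar_of_shapes hGV hA hB hG hLiftF
    (fun W _ _ p _ κ _ _ f S₀ Φ₀ hΦ hp hgood hord hκ hram heven hf hS₀ hS ↦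
      hAnF W p κ f S₀ Φ₀ hΦ hp hgood hord hκ hram heven hf hS₀ hS)
    hP hW16

end Summit.BirchSwinnertonDyer.Rank1Residual.X2.GreenbergVatsalThm13GoodOrdinary

end
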